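import Summits.AnomalousDissipation.AnomalousDissipation.Theses.ClassTrim

/-!
# The three glue items of `route-AnomalousDissipation-ClassTrim` (pure logic)

* `EnergyRegimeGlue` (stmt-AnomalousDissipation-33308): `LargeEnergyPlanarity → BoundedQuietPlanarity →
  QuietTrajectoriesRelativelyPlanar` — case split on `M ≤ meanEnergy u` (lens-4 g13 EnergyRegimePlanarity; by-name
  certificate `g13/pkg/ByName_g13.lean`, theorem `energyRegimeGlue_byName`).
* `LandingEjectGlue` (stmt-AnomalousDissipation-32463): `TurbulentPlanarLanding → LandedDataEject →
  TurbulentNonRelaxingDataEject` — `ν₀ := min ν₀ ν₁` and modus ponens (lens-4 g11 LandedEjection; `g11/pkg/PasteCheck_g11.lean`).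
* `RecurrenceGlue` (stmt-AnomalousDissipation-32997): `EjectionRecurs → RecurrentEjectionPersists → EjectionPersists` —
  modus ponens (lens-4 g12 RecurrentEjection; `g12/pkg/PasteCheck_g12.lean`).
Also the kernel-necessity directions (parent ⇒ child) recording that each cut is a restriction.  No facts are asserted.
Source: decomp-ad cell (lens-4 g11–g13 packages under `run/shared/lean/pub/decomp-ad/decomp-ad-lens-4/`); landed by the cell's
prover seat.  Nothing here proves the summit.
-/

set_option linter.dupNamespace false

namespace Summit.AnomalousDissipation.AnomalousDissipation.Theorems.ClassTrimGlues

open Summit.AnomalousDissipation.AnomalousDissipation.Theses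
open Summit.AnomalousDissipation.AnomalousDissipation.Theses.ClassTrim

/-- GLUE item 33308: the energy-regime cut of `QuietTrajectoriesRelativelyPlanar` recombines (case split on the
mean energy against the large-energy threshold `M`). [folklore] -/
theorem energyRegimeGlue_holds : EnergyRegimeGlue := by
  intro hLEP hBQP δ hδ
  obtain ⟨M, hM, hhigh⟩ := hLEP δ hδ
  obtain ⟨θ₀, hθ₀, hlow⟩ := hBQP δ hδ M hM
  refine ⟨θ₀, hθ₀, fun ν hν hν1 u₀ u hu hq => ?_⟩
  rcases le_or_gt M (Literature.Analysis.FluidPDE.meanEnergy u) with hE | hE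
  · exact hhigh ν hν hν1 u₀ u hu hE
  · exact hlow ν hν hν1 u₀ u hu hE.le hq

/-- Kernel necessity of the bounded-energy half: `QuietTrajectoriesRelativelyPlanar → BoundedQuietPlanarity`
(33307 is the parent restricted to bounded energy). [folklore] -/
theorem boundedQuietPlanarity_of_parent (hHR : QuietTrajectoriesRelativelyPlanar) : BoundedQuietPlanarity := by
  intro φ hφ M _
  obtain ⟨θ₀, hθ₀, h⟩ := hHR φ hφ
  exact ⟨θ₀, hθ₀, fun ν hν hν1 u₀ u hu _ hq => h ν hν hν1 u₀ u hu hq⟩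

/-- GLUE item 32463: planar landing of turbulent non-relaxing data followed by ejection of landed data gives the
parent ejection statement (take `ν₀ := min ν₀ ν₁`). [folklore] -/
theorem landingEjectGlue_holds : LandingEjectGlue := by
  intro hL hE
  obtain ⟨c₀, hc₀, ν₀, hν₀, δ, hδ, H⟩ := hE
  obtain ⟨ν₁, hν₁, HL⟩ := hL δ hδ
  refine ⟨c₀, hc₀, min ν₀ ν₁, lt_min hν₀ hν₁, ?_⟩
  intro ν hν hνle p hp hcls v₀ hex hmem hzero hpl hpos hrel
  exact H ν hν (hνle.trans (min_le_left _ _)) p hp hcls v₀ hex hmem hzero hpl hpos hrel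
    (HL ν hν (hνle.trans (min_le_right _ _)) p hp hcls v₀ hex hmem hzero hpl hpos hrel)

/-- Kernel necessity of the landed-eject half: `TurbulentNonRelaxingDataEject → LandedDataEject` (δ := 1, the landing
hypothesis is simply dropped). [folklore] -/
theorem landedDataEject_of_parent (h : TurbulentNonRelaxingDataEject) : LandedDataEject := by
  obtain ⟨c₀, hc₀, ν₀, hν₀, H⟩ := h
  exact ⟨c₀, hc₀, ν₀, hν₀, 1, one_pos, fun ν hν hνle p hp hcls v₀ hex hmem hzero hpl hpos hrel _ =>
    H ν hν hνle p hp hcls v₀ hex hmem hzero hpl hpos hrel⟩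

/-- GLUE item 32997: recurrence of ejection plus persistence-given-recurrence gives persistence (modus ponens). [folklore] -/
theorem recurrenceGlue_holds : RecurrenceGlue :=
  fun hA hB hP => hB (hA hP) hP

/-- Kernel necessity of the recurrent half: `EjectionPersists → RecurrentEjectionPersists`. [folklore] -/
theorem recurrentEjectionPersists_of_parent (hX : EjectionPersists) : RecurrentEjectionPersists :=
  fun _ hP => hX hP

end Summit.AnomalousDissipation.AnomalousDissipation.Theorems.ClassTrimGlues
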